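import Summits.FinalStateConjecture.FinalStateConjecture.Theorems.PhotonSphereChannelsExteriorEnergyRW

/-!
# Route PhotonSphereChannels — the Regge–Wheeler potential is repulsive at both ends of the tortoise line
# (weights `r − 3M` towards null infinity, `x_c − x` towards the horizon)

Helper file for sub-goal `stub_compactExhaustionOfLocalDecay` of stub H4 of line `isolated-kerr-connected-hull`
(crux stmt-FinalStateConjecture-14075), over `ReggeWheeler.{rwPotential, linePotential, IsTortoiseRadius}`.
For the weighted transport identities of `…RWeightedTransport` one needs weights `w` vanishing at the centre
`x_c` whose bulk coefficient `−κ (wV)′` dominates a multiple of `V` far out.  With `V = V_{s,ℓ} ∘ r`,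
`s ≤ 2`, `s ≤ ℓ`, `λ = ℓ(ℓ+1)`, `μ = 2M(1 − s²)`:

* `RW.hasDerivAt_rwPotential`, `RW.hasDerivAt_linePotential` — `V′ = V_{s,ℓ}′(r) · (1 − 2M/r)`;
* `RW.rwPotential_repulsive_far` — for `ρ ≥ 30M`: `V_{s,ℓ}(ρ) + (ρ − 3M) V_{s,ℓ}′(ρ) ≤ −V_{s,ℓ}(ρ)/2`
  (`ρ⁵ ×` the difference is the cubic `−λρ³/2 + (9Mλ − 3μ/2)ρ² + (14Mμ − 18M²λ)ρ − 24M²μ ≤ 0`);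
* `RW.linePotential_repulsive_right` — RIGHT weight `w = r − 3M` (`w(x_c) = 0`, `w′ = 1 − 2M/r ≥ 1/3` on
  `x ≥ x_c`): `V/6 ≤ −((r − 3M)V′ + (1 − 2M/r)V)` beyond some `x₁ ≥ x_c + 1`, bounded on `[x_c, x₁]`;
* `RW.linePotential_repulsive_left` — LEFT weight `w = x_c − x`: `V ≤ (x_c − x)V′ − V` below some
  `x₀ ≤ x_c − 1` (`V_{s,ℓ}′(2M) = (λ + 1 − s²)/(8M³) > 0`, `r → 2M`), bounded on `[x₀, x_c]`.

The inequalities are stated literally in the hypothesis format of `WaveEnergy.weighted_box_estimate_Ioo`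
(`κ = 1`, resp. `κ = −1`).  No definitions. [folklore]
-/

namespace Summit.FinalStateConjecture.FinalStateConjecture.Theorems

-- every `Summit.FinalStateConjecture.FinalStateConjecture.…` name repeats the summit = sub-problem
-- segment (D-0017 layout), as in every landed `…Theorems` file of this route
set_option linter.dupNamespace false

open MeasureTheory Set Filter Topology
open Literature.Geometry.Lorentzian Literature.Geometry.Lorentzian.ReggeWheeler

noncomputable section

namespace RW

variable {M : ℝ} {r : ℝ → ℝ} {xc : ℝ} {s ℓ : ℕ}

/-! ### Derivatives of the potential -/

/-- `dV_{s,ℓ}/dρ = (2M/ρ²)(λ/ρ² + μ/ρ³) + (1 − 2M/ρ)(−2λ/ρ³ − 3μ/ρ⁴)` for `ρ ≠ 0`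
(`λ = ℓ(ℓ+1)`, `μ = 2M(1 − s²)`). [folklore] -/
theorem hasDerivAt_rwPotential (M : ℝ) (s ℓ : ℕ) {ρ : ℝ} (hρ : ρ ≠ 0) :
    HasDerivAt (rwPotential M s ℓ)
      (2 * M / ρ ^ 2 * ((ℓ : ℝ) * ((ℓ : ℝ) + 1) / ρ ^ 2 + (1 - (s : ℝ) ^ 2) * (2 * M) / ρ ^ 3)
        + (1 - 2 * M / ρ) * (-(2 * ((ℓ : ℝ) * ((ℓ : ℝ) + 1))) / ρ ^ 3
          - 3 * ((1 - (s : ℝ) ^ 2) * (2 * M)) / ρ ^ 4)) ρ := by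
  have hid : HasDerivAt (fun y : ℝ => y) 1 ρ := hasDerivAt_id' ρ
  have h1 := (hasDerivAt_const ρ (2 * M)).fun_div hid hρ
  have h2 := (hasDerivAt_const ρ ((ℓ : ℝ) * ((ℓ : ℝ) + 1))).fun_div (hid.fun_pow 2)
    (pow_ne_zero 2 hρ)
  have h3 := (hasDerivAt_const ρ ((1 - (s : ℝ) ^ 2) * (2 * M))).fun_div (hid.fun_pow 3)
    (pow_ne_zero 3 hρ)
  have h := ((hasDerivAt_const ρ (1 : ℝ)).fun_sub h1).fun_mul (h2.fun_add h3)
  refine h.congr_deriv ?_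
  push_cast
  field_simp
  ring

/-- Chain rule along a tortoise radius function: `V′(x) = V_{s,ℓ}′(r x) · (1 − 2M/r x)`. [folklore] -/
theorem hasDerivAt_linePotential (hr : IsTortoiseRadius M r xc) (s ℓ : ℕ) (x : ℝ) :
    HasDerivAt (linePotential M s ℓ r)
      ((2 * M / r x ^ 2 * ((ℓ : ℝ) * ((ℓ : ℝ) + 1) / r x ^ 2 + (1 - (s : ℝ) ^ 2) * (2 * M) / r x ^ 3)
        + (1 - 2 * M / r x) * (-(2 * ((ℓ : ℝ) * ((ℓ : ℝ) + 1))) / r x ^ 3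
          - 3 * ((1 - (s : ℝ) ^ 2) * (2 * M)) / r x ^ 4)) * (1 - 2 * M / r x)) x :=
  (hasDerivAt_rwPotential M s ℓ (hr.pos x).ne').comp x (hr.hasDerivAt x)

/-- The line potential is `C¹` along a tortoise radius function. [folklore] -/
theorem contDiff_one_linePotential (hr : IsTortoiseRadius M r xc) (s ℓ : ℕ) :
    ContDiff ℝ 1 (linePotential M s ℓ r) := by
  have h1 : ContDiff ℝ 1 r := hr.contDiff_one
  have hr0 : ∀ x, r x ≠ 0 := fun x => (hr.pos x).ne'
  unfold linePotential rwPotential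
  exact (contDiff_const.sub (contDiff_const.div h1 hr0)).mul
    ((contDiff_const.div (h1.pow 2) fun x => pow_ne_zero 2 (hr0 x)).add
      (contDiff_const.div (h1.pow 3) fun x => pow_ne_zero 3 (hr0 x)))

/-! ### Repulsivity far out (null-infinity end) -/

/-- **Far-field repulsivity of the Regge–Wheeler potential.** For `M > 0`, `s ≤ 2`, `s ≤ ℓ` and
`ρ ≥ 30M`: `V_{s,ℓ}(ρ) + (ρ − 3M) V_{s,ℓ}′(ρ) ≤ −V_{s,ℓ}(ρ)/2`. [folklore] -/
theorem rwPotential_repulsive_far (hM : 0 < M) (hs : s ≤ 2) (hsℓ : s ≤ ℓ) {ρ : ℝ} (hρ : 30 * M ≤ ρ) :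
    rwPotential M s ℓ ρ + (ρ - 3 * M)
        * (2 * M / ρ ^ 2 * ((ℓ : ℝ) * ((ℓ : ℝ) + 1) / ρ ^ 2 + (1 - (s : ℝ) ^ 2) * (2 * M) / ρ ^ 3)
          + (1 - 2 * M / ρ) * (-(2 * ((ℓ : ℝ) * ((ℓ : ℝ) + 1))) / ρ ^ 3
            - 3 * ((1 - (s : ℝ) ^ 2) * (2 * M)) / ρ ^ 4))
      ≤ -(rwPotential M s ℓ ρ) / 2 := by
  have hρ0 : 0 < ρ := by linarith
  set L : ℝ := (ℓ : ℝ) * ((ℓ : ℝ) + 1) with hL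
  set μ : ℝ := (1 - (s : ℝ) ^ 2) * (2 * M) with hμ
  -- clear denominators
  have key : ρ ^ 5 * (rwPotential M s ℓ ρ + (ρ - 3 * M)
      * (2 * M / ρ ^ 2 * (L / ρ ^ 2 + μ / ρ ^ 3) + (1 - 2 * M / ρ) * (-(2 * L) / ρ ^ 3 - 3 * μ / ρ ^ 4))
      + rwPotential M s ℓ ρ / 2)
      = -L * ρ ^ 3 / 2 + (9 * M * L - 3 * μ / 2) * ρ ^ 2 + (14 * M * μ - 18 * M ^ 2 * L) * ρ
        - 24 * M ^ 2 * μ := by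
    unfold rwPotential
    field_simp
    ring
  -- the cubic is non-positive for `ρ ≥ 30M`
  have hF8 : 0 ≤ M * ρ * (ρ - 30 * M) := mul_nonneg (mul_nonneg hM.le hρ0.le) (by linarith)
  have hF9 : 0 ≤ M ^ 2 * (ρ - 30 * M) := mul_nonneg (by positivity) (by linarith)
  have hM3 : 0 ≤ M ^ 3 := by positivity
  have hN : -L * ρ ^ 3 / 2 + (9 * M * L - 3 * μ / 2) * ρ ^ 2 + (14 * M * μ - 18 * M ^ 2 * L) * ρ
      - 24 * M ^ 2 * μ ≤ 0 := by
    rcases Nat.eq_zero_or_pos ℓ with hℓ | hℓ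
    · have hs0 : s = 0 := by omega
      subst hℓ hs0
      have hL0 : L = 0 := by rw [hL]; push_cast; ring
      have hμ0 : μ = 2 * M := by rw [hμ]; push_cast; ring
      rw [hL0, hμ0]
      nlinarith [hF8, hF9, hM3]
    · have hℓ1 : (1 : ℝ) ≤ ℓ := by exact_mod_cast hℓ
      have hL2 : 2 ≤ L := by rw [hL]; nlinarith
      have hs4 : (s : ℝ) ^ 2 ≤ 4 := by
        have : (s : ℝ) ≤ 2 := by exact_mod_cast hs
        nlinarith [this, (Nat.cast_nonneg s : (0 : ℝ) ≤ s)]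
      have hμ6 : 0 ≤ μ + 6 * M := by rw [hμ]; nlinarith
      have hμ2 : 0 ≤ 2 * M - μ := by rw [hμ]; nlinarith [sq_nonneg (s : ℝ)]
      have hF1 : 0 ≤ (μ + 6 * M) * ρ ^ 2 := mul_nonneg hμ6 (by positivity)
      have hF2 : 0 ≤ (2 * M - μ) * (M * ρ) := mul_nonneg hμ2 (by positivity)
      have hF3 : 0 ≤ (μ + 6 * M) * M ^ 2 := mul_nonneg hμ6 (by positivity)
      have hF4 : 0 ≤ L * ρ ^ 2 * (ρ - 30 * M) :=
        mul_nonneg (mul_nonneg (by linarith) (by positivity)) (by linarith)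
      have hF5 : 0 ≤ (L - 2) * (M * ρ ^ 2) := mul_nonneg (by linarith) (by positivity)
      have hF6 : 0 ≤ (L - 2) * (M ^ 2 * ρ) := mul_nonneg (by linarith) (by positivity)
      nlinarith [hF1, hF2, hF3, hF4, hF5, hF6, hF8, hF9, hM3]
  have hle : rwPotential M s ℓ ρ + (ρ - 3 * M)
      * (2 * M / ρ ^ 2 * (L / ρ ^ 2 + μ / ρ ^ 3) + (1 - 2 * M / ρ) * (-(2 * L) / ρ ^ 3 - 3 * μ / ρ ^ 4))
      + rwPotential M s ℓ ρ / 2 ≤ 0 := by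
    by_contra hcon
    push Not at hcon
    have := mul_pos (pow_pos hρ0 5) hcon
    linarith
  linarith

/-- **Right repulsivity along the tortoise line** (weight `w = r − 3M`, `κ = 1`, constant `c = 1/6`): there are
`x₁ ≥ x_c + 1` and `C ≥ 0` with `V/6 ≤ −((r − 3M)V′ + (1 − 2M/r)V)` on `x > x₁` and
`−C ≤ −((r − 3M)V′ + (1 − 2M/r)V)` on `[x_c, x₁]`. [folklore] -/
theorem linePotential_repulsive_right (hr : IsTortoiseRadius M r xc) (hs : s ≤ 2) (hsℓ : s ≤ ℓ) :
    ∃ x₁ C : ℝ, xc + 1 ≤ x₁ ∧ 0 ≤ C ∧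
      (∀ x, x₁ < x → 1 / 6 * linePotential M s ℓ r x
        ≤ -(1 * ((r x - 3 * M) * deriv (linePotential M s ℓ r) x
            + (1 - 2 * M / r x) * linePotential M s ℓ r x))) ∧
      (∀ x ∈ Icc xc x₁, -C ≤ -(1 * ((r x - 3 * M) * deriv (linePotential M s ℓ r) x
            + (1 - 2 * M / r x) * linePotential M s ℓ r x))) := by
  have hM := hr.mass_pos
  obtain ⟨xP, hxP⟩ := tendsto_atTop_atTop.1 hr.tendsto_atTop (30 * M)
  set x₁ := max xP (xc + 1) with hx₁
  have hVd : ContDiff ℝ 1 (linePotential M s ℓ r) := contDiff_one_linePotential hr s ℓ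
  have hNc : Continuous fun x => (r x - 3 * M) * deriv (linePotential M s ℓ r) x
      + (1 - 2 * M / r x) * linePotential M s ℓ r x := by
    have h1 := hr.continuous
    have h2 := hVd.continuous_deriv le_rfl
    have h3 := hVd.continuous
    have h4 : ∀ x, r x ≠ 0 := fun x => (hr.pos x).ne'
    fun_prop (disch := exact h4 _)
  obtain ⟨C, hC⟩ := isCompact_Icc.exists_bound_of_continuousOn (s := Icc xc x₁) hNc.continuousOn
  refine ⟨x₁, max C 0, le_max_right _ _, le_max_right _ _, fun x hx => ?_, fun x hx => ?_⟩
  · have h30 : 30 * M ≤ r x := hxP x ((le_max_left _ _).trans hx.le)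
    have hfar := rwPotential_repulsive_far (ℓ := ℓ) hM hs hsℓ h30
    rw [(hasDerivAt_linePotential hr s ℓ x).deriv, linePotential_apply]
    have ht : 1 / 3 ≤ 1 - 2 * M / r x := by
      have hrx : 0 < r x := hr.pos x
      have : 2 * M / r x ≤ 2 / 3 := by
        rw [div_le_iff₀ hrx]
        linarith
      linarith
    have ht1 : 1 - 2 * M / r x ≤ 1 := (hr.deriv_lt_one x).le
    have hf0 : 0 ≤ rwPotential M s ℓ (r x) := linePotential_nonneg hM.le hsℓ hr.two_mul_lt x
    set A := rwPotential M s ℓ (r x) + (r x - 3 * M)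
        * (2 * M / r x ^ 2 * ((ℓ : ℝ) * ((ℓ : ℝ) + 1) / r x ^ 2 + (1 - (s : ℝ) ^ 2) * (2 * M) / r x ^ 3)
          + (1 - 2 * M / r x) * (-(2 * ((ℓ : ℝ) * ((ℓ : ℝ) + 1))) / r x ^ 3
            - 3 * ((1 - (s : ℝ) ^ 2) * (2 * M)) / r x ^ 4)) with hA
    have hA0 : A ≤ 0 := by linarith
    have hprod : 0 ≤ (1 - 2 * M / r x - 1 / 3) * (-A) := mul_nonneg (by linarith) (by linarith)
    nlinarith [hprod, hfar, hf0, ht, ht1]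
  · have h := hC x hx
    rw [Real.norm_eq_abs] at h
    have := (abs_le.1 h).2
    linarith [le_max_left C 0]

/-! ### Repulsivity towards the horizon -/

/-- **Left repulsivity along the tortoise line** (weight `w = x_c − x`, `κ = −1`, constant `c = 1`): there are
`x₀ ≤ x_c − 1` and `C ≥ 0` with `V ≤ (x_c − x)V′ − V` on `x < x₀` and `(x_c − x)V′ − V ≥ −C` on `[x₀, x_c]`
(`V_{s,ℓ}′(2M) = (λ + 1 − s²)/(8M³) > 0` and `r(x) → 2M` as `x → −∞`). [folklore] -/
theorem linePotential_repulsive_left (hr : IsTortoiseRadius M r xc) (hs : s ≤ 2) (hsℓ : s ≤ ℓ) :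
    ∃ x₀ C : ℝ, x₀ ≤ xc - 1 ∧ 0 ≤ C ∧
      (∀ x, x < x₀ → 1 * linePotential M s ℓ r x
        ≤ -((-1) * ((xc - x) * deriv (linePotential M s ℓ r) x
            + (-1) * linePotential M s ℓ r x))) ∧
      (∀ x ∈ Icc x₀ xc, -C ≤ -((-1) * ((xc - x) * deriv (linePotential M s ℓ r) x
            + (-1) * linePotential M s ℓ r x))) := by
  have hM := hr.mass_pos
  have _ := hs
  set L : ℝ := (ℓ : ℝ) * ((ℓ : ℝ) + 1) with hL
  set μ : ℝ := (1 - (s : ℝ) ^ 2) * (2 * M) with hμ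
  -- the `ρ`-derivative of the potential, its value at the horizon and its continuity there
  set D : ℝ → ℝ := fun ρ => 2 * M / ρ ^ 2 * (L / ρ ^ 2 + μ / ρ ^ 3)
    + (1 - 2 * M / ρ) * (-(2 * L) / ρ ^ 3 - 3 * μ / ρ ^ 4) with hD
  have hD2 : D (2 * M) = (L + 1 - (s : ℝ) ^ 2) / (8 * M ^ 3) := by
    simp only [hD, hμ]
    field_simp
    ring
  have hsL : (s : ℝ) ^ 2 ≤ L := by
    have h1 : (s : ℝ) ≤ ℓ := by exact_mod_cast hsℓ
    have h2 : (0 : ℝ) ≤ s := Nat.cast_nonneg s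
    have h3 : (0 : ℝ) ≤ ℓ := Nat.cast_nonneg ℓ
    rw [hL]
    nlinarith
  have hDpos : 0 < D (2 * M) := by
    rw [hD2]
    exact div_pos (by linarith) (by positivity)
  have hDc : ContinuousAt D (2 * M) := by
    have h2M : (2 * M) ≠ 0 := by positivity
    simp only [hD]
    fun_prop (disch := positivity)
  obtain ⟨δ, hδ, hδD⟩ := Metric.continuousAt_iff.1 hDc (D (2 * M) / 2) (half_pos hDpos)
  obtain ⟨xN, hxN⟩ := eventually_atBot.1 (Metric.tendsto_nhds.1 hr.tendsto_atBot δ hδ)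
  set Pmax : ℝ := (L + 1) / (4 * M ^ 2) with hPmax
  have hPmax0 : 0 ≤ Pmax := by positivity
  set x₀ : ℝ := min (min xN (xc - 1)) (xc - 4 * Pmax / D (2 * M)) with hx₀
  have hVd : ContDiff ℝ 1 (linePotential M s ℓ r) := contDiff_one_linePotential hr s ℓ
  have hNc : Continuous fun x => (xc - x) * deriv (linePotential M s ℓ r) x
      + (-1) * linePotential M s ℓ r x := by
    have h2 := hVd.continuous_deriv le_rfl
    have h3 := hVd.continuous
    fun_prop
  obtain ⟨C, hC⟩ := isCompact_Icc.exists_bound_of_continuousOn (s := Icc x₀ xc) hNc.continuousOn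
  have hx₀1 : x₀ ≤ xc - 1 := (min_le_left _ _).trans (min_le_right _ _)
  refine ⟨x₀, max C 0, hx₀1, le_max_right _ _, fun x hx => ?_, fun x hx => ?_⟩
  · -- far left: `(xc − x) D(r x) ≥ 2 P(r x)`
    have hxm : x ≤ xN := hx.le.trans ((min_le_left _ _).trans (min_le_left _ _))
    have hxc : 4 * Pmax / D (2 * M) ≤ xc - x := by
      have := hx.le.trans (min_le_right _ _)
      linarith
    have hDx : D (2 * M) / 2 ≤ D (r x) := by
      have h := hδD (hxN x hxm)
      rw [Real.dist_eq] at h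
      have := (abs_lt.1 h).1
      linarith
    have hrx : 0 < r x := hr.pos x
    have h2r : 2 * M < r x := hr.two_mul_lt x
    have hP : L / r x ^ 2 + μ / r x ^ 3 ≤ Pmax := by
      have h4 : (2 * M) ^ 2 ≤ r x ^ 2 := by gcongr
      have h8 : (2 * M) ^ 3 ≤ r x ^ 3 := by gcongr
      have hL0 : 0 ≤ L := by rw [hL]; positivity
      have hμ2 : μ ≤ 2 * M := by rw [hμ]; nlinarith [sq_nonneg (s : ℝ)]
      have i1 : L / r x ^ 2 ≤ L / (2 * M) ^ 2 := div_le_div_of_nonneg_left hL0 (by positivity) h4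
      have i2 : μ / r x ^ 3 ≤ 2 * M / (2 * M) ^ 3 :=
        (div_le_div_of_nonneg_right hμ2 (by positivity)).trans
          (div_le_div_of_nonneg_left (by positivity) (by positivity) h8)
      have e : L / (2 * M) ^ 2 + 2 * M / (2 * M) ^ 3 = Pmax := by
        rw [hPmax]
        field_simp
        ring
      linarith
    have hxD : 2 * Pmax ≤ (xc - x) * D (r x) := by
      have h1 : 4 * Pmax / D (2 * M) * (D (2 * M) / 2) = 2 * Pmax := by
        field_simp
        ring
      rw [← h1]
      exact mul_le_mul hxc hDx (by positivity) (by linarith [div_nonneg (by positivity : 0 ≤ 4 * Pmax) hDpos.le])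
    rw [(hasDerivAt_linePotential hr s ℓ x).deriv, linePotential_apply]
    have hV : rwPotential M s ℓ (r x) = (1 - 2 * M / r x) * (L / r x ^ 2 + μ / r x ^ 3) := by
      rw [hL, hμ]
      rfl
    have ht : 0 < 1 - 2 * M / r x := hr.deriv_pos x
    have hDr : D (r x) = 2 * M / r x ^ 2 * ((ℓ : ℝ) * ((ℓ : ℝ) + 1) / r x ^ 2
        + (1 - (s : ℝ) ^ 2) * (2 * M) / r x ^ 3) + (1 - 2 * M / r x)
        * (-(2 * ((ℓ : ℝ) * ((ℓ : ℝ) + 1))) / r x ^ 3 - 3 * ((1 - (s : ℝ) ^ 2) * (2 * M)) / r x ^ 4) := by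
      simp only [hD, hL, hμ]
      try ring
    rw [← hDr, hV]
    nlinarith [mul_le_mul_of_nonneg_left (hP.trans (by linarith : Pmax ≤ Pmax)) ht.le,
      mul_le_mul_of_nonneg_left hxD ht.le, mul_nonneg ht.le hPmax0]
  · have h := hC x hx
    rw [Real.norm_eq_abs] at h
    have := (abs_le.1 h).1
    linarith [le_max_left C 0]

/-- **Registered sub-goal `stub_h4PotentialRepulsion`** (crux stmt-FinalStateConjecture-14075, line
`isolated-kerr-connected-hull`, towards `stub_compactExhaustionOfLocalDecay`): the Regge–Wheeler potential
is repulsive at both ends of the tortoise line, in the hypothesis format of the weighted box estimate.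
[folklore] -/
theorem stub_h4PotentialRepulsion : ∀ (M : ℝ) (r : ℝ → ℝ) (xc : ℝ), ReggeWheeler.IsTortoiseRadius M r xc →
    ∀ (s ℓ : ℕ), s ≤ 2 → s ≤ ℓ →
    (∃ x₁ C : ℝ, xc + 1 ≤ x₁ ∧ 0 ≤ C ∧
      (∀ x, x₁ < x → 1 / 6 * ReggeWheeler.linePotential M s ℓ r x
        ≤ -(1 * ((r x - 3 * M) * deriv (ReggeWheeler.linePotential M s ℓ r) x
            + (1 - 2 * M / r x) * ReggeWheeler.linePotential M s ℓ r x))) ∧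
      (∀ x ∈ Set.Icc xc x₁, -C ≤ -(1 * ((r x - 3 * M) * deriv (ReggeWheeler.linePotential M s ℓ r) x
            + (1 - 2 * M / r x) * ReggeWheeler.linePotential M s ℓ r x)))) ∧
    (∃ x₀ C : ℝ, x₀ ≤ xc - 1 ∧ 0 ≤ C ∧
      (∀ x, x < x₀ → 1 * ReggeWheeler.linePotential M s ℓ r x
        ≤ -((-1) * ((xc - x) * deriv (ReggeWheeler.linePotential M s ℓ r) x
            + (-1) * ReggeWheeler.linePotential M s ℓ r x))) ∧
      (∀ x ∈ Set.Icc x₀ xc, -C ≤ -((-1) * ((xc - x) * deriv (ReggeWheeler.linePotential M s ℓ r) x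
            + (-1) * ReggeWheeler.linePotential M s ℓ r x)))) :=
  fun _ _ _ hr _ _ hs hsℓ => ⟨linePotential_repulsive_right hr hs hsℓ, linePotential_repulsive_left hr hs hsℓ⟩

end RW

end

end Summit.FinalStateConjecture.FinalStateConjecture.Theorems
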